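import Summits.QuantumFields.YangMills.Theorems.BalabanUVNodesN15KingModelFreeRGThm31Rates
import HarnessLib

/-!
# BalabanUVNodes ∕ N15 — THE KING-MODEL RUNG, FREE-FIELD EDITION (PART Τ-g): [King1986] **THEOREM 3.1 (3.3)–(3.4) BY NAME** and the
# **ULTRA-VIOLET STABILITY BOUND BY NAME** — `RGData.Thm31Printed (kingFreeRG L M₀ a m² b₀ p)` and `RGData.UVStable (kingFreeRG …)` for the free
# massive lattice scalar field at `A = 0`, plus the schema's side hypotheses `χ_k ∈ {0,1}` and finiteness of the small-field integrals
# (Track A, DAG node N15 = NE2; FAN-OUT v1.1 §N15 s3 «KING-MODEL RUNG»; regen R453 (b))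

HONEST FRAMING.  Count-neutral (cell `pub-ymgap`, seat `pub-ymgap-dag-n15-e` g19; `--supports stmt-QuantumFields-27366 --as helper` = K3⁸
`SpineGivenEndpointR13SepCoPHV`).  TEMPLATE LITERATURE, `A = 0`: [King1986] Theorem 3.1 p. 655 (*"the basic results of the papers [Ba 1–2]"*:
`∫χ_k e^{−S^{(k),1} + C(L^kε_K)^σ|T|} ≤ Z^{ε_K} ≤ ∫χ_k e^{−S^{(k),1} + C(L^kε_K)^σ|T|} + exp[−p(L^kε_K)² + C|T|]` for `K ≥ J`, `k ≤ K − J`) and the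
ultra-violet stability input `e^{−C₁|T|} ≤ Z^{ε_K} ≤ e^{C₂|T|}` (p. 657 ∕ [King1986II] (4.2)) — PRINTED hypotheses of King's continuum-limit theorem,
proved in [Ba 1–4] for the interacting model; here DECIDED for the free-field datum of part Τ-e, where `Z^{ε_K} ≡ 1` (King's normalisation (2.6)), the
stability bound is an equality (`C₁ = C₂ = 0`), (3.3) is `∫χρ ≤ ∫ρ = 1` (part Τ-g₁ `smallField_le_one`, correction constant `C = 0`), and (3.4) is the
Gaussian large-field estimate `1 − ∫χ_kρ ≤ 2|T₁^{(k)}|e^{−R_m²∕(2G_m)} ≤ e^{−p(ε_m)²}` for `m = K − k ≥ J` (parts Τ-b Chernoff ∕ Τ-c variance ∕ Τ-g₁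
∕ Τ-g₂ `exists_J_largeField`; `σ = 1` displayed, unused since `C = 0`).  Also `chi_zero_or_one_kingFreeRG` and `hfin_kingFreeRG` — the two side
hypotheses of the typer's deduction `RGData.hasContinuumLimit_of_thm31_thm34`, which part Τ-h fires.  HONEST SCOPE: datum of part Τ-e (cubic torus
`|T| = M₀^d`, `h = g = 0`, φ-clause of (3.2) at `λ := 1`, `S^{(k),1}` in closed Gaussian form); `1 ≤ d ≤ 3` (King: `d = 2, 3`), `L ≥ 2`, `a, m², b₀ > 0`,
`p ≥ 0`; the index `J` depends on the letters incl. `|T|`.  NOT Bałaban's [Ba 1–4] theorems; NOT the interacting U(1)-Higgs model; NOT a node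
discharge; nothing continuum-YM ∕ ℝ⁴ ∕ OS ∕ mass-gap ∕ Clay.  0 `sorry`, 0 `def`; standard axioms.
Locators: [King1986] (2.6) p.652, (3.1)–(3.2) p.655, Thm 3.1 (3.3)–(3.4) p.655, p.657 («the ultra-violet stability bound»); [King1986II] (4.2) p.336.
-/

noncomputable section

namespace Summit.QuantumFields.YangMills.BalabanUVNodes.N15KingModelRung.FreeField

open Real Finset Matrix MeasureTheory
open Literature.MathematicalPhysics.QuantumFieldTheory.Balaban1983to89 (B2.pFn)
open Literature.MathematicalPhysics.QuantumFieldTheory.Balaban1983to89.B5Prop11Plancherel (Tor)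
open Literature.MathematicalPhysics.QuantumFieldTheory.King1986.ContinuumLimit (eps eps_pos eps_le_one RGData)

variable {d : ℕ}

section Main

variable (L : ℕ) [NeZero L] (M₀ : ℕ) [NeZero M₀]

/-- **`χ_k ∈ {0, 1}`** for the datum (the schema's `hχ`). [cite: King1986, (3.2) p.655] -/
theorem chi_zero_or_one_kingFreeRG (a msq b₀ p : ℝ) :
    ∀ (m : ℕ) (x : Tor (cubeSide (d := d) M₀ L m) → ℝ),
      (kingFreeRG (d := d) L M₀ a msq b₀ p).chi m x = 0 ∨ (kingFreeRG (d := d) L M₀ a msq b₀ p).chi m x = 1 :=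
  fun m x => kingFreeChi_zero_or_one L M₀ b₀ p m x

/-- **The small-field integrals are finite** (the schema's `hfin`): `∫χ_k e^{−S^{(k),1} + C(L^kε_K)^σ|T|} dφ_k < ∞` for all `C, σ, m, k`.
[cite: King1986, Thm 3.1 (3.3) p.655] -/
theorem hfin_kingFreeRG {a msq : ℝ} (ha : 0 < a) (hL : 2 ≤ L) (hmsq : 0 < msq) (b₀ p : ℝ) :
    ∀ (C σ : ℝ) (m k : ℕ), Integrable (fun x => (kingFreeRG (d := d) L M₀ a msq b₀ p).chi m x
        * Real.exp (-((kingFreeRG (d := d) L M₀ a msq b₀ p).S m k x) + C * (eps (kingFreeRG (d := d) L M₀ a msq b₀ p).L m) ^ σ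
            * (kingFreeRG (d := d) L M₀ a msq b₀ p).vol)) ((kingFreeRG (d := d) L M₀ a msq b₀ p).μ m) :=
  fun C σ m k => integrable_chi_exp (d := d) L M₀ ha hL hmsq b₀ p m k (C * eps L m ^ σ * (M₀ : ℝ) ^ d)

/-- ★★★ **THE ULTRA-VIOLET STABILITY BOUND BY NAME**: `RGData.UVStable (kingFreeRG …)` — `e^{−C₁|T|} ≤ Z^{ε_K} ≤ e^{C₂|T|}` with `C₁ = C₂ = 0`,
since the free field's `Z^{ε_K} ≡ 1` by King's normalisation (2.6) (p. 657: *"The uniform bound in Theorem 2.1 is just the statement of ultra-violet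
stability"*). [cite: King1986, (2.6) p.652, p.657; King1986II, (4.2) p.336] -/
theorem uvStable_kingFreeRG (a msq b₀ p : ℝ) : (kingFreeRG (d := d) L M₀ a msq b₀ p).UVStable :=
  ⟨0, 0, fun K => by simp [kingFreeRG]⟩

/-- ★★★ **[King1986] THEOREM 3.1 (3.3)–(3.4) BY NAME FOR THE FREE MASSIVE LATTICE SCALAR FIELD AT `A = 0`**: for `1 ≤ d ≤ 3`, `L ≥ 2`, `M₀ ≥ 1`,
`a, m², b₀ > 0`, `p ≥ 0`, the datum `kingFreeRG L M₀ a m² b₀ p` satisfies the typer's schema `RGData.Thm31Printed`: there are `J`, `σ > 0`, `C` (here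
`σ = 1`, `C = 0`) with `∫χ_k e^{−S^{(k),1} + C(L^kε_K)^σ|T|} ≤ Z^{ε_K} ≤ ∫χ_k e^{−S^{(k),1} + C(L^kε_K)^σ|T|} + exp[−p(L^kε_K)² + C|T|]` for all
`K − k = m ≥ J` and all `k` — (3.3) by mass one, (3.4) by the Gaussian large-field estimate. [cite: King1986, Thm 3.1 (3.3)–(3.4) p.655] -/
theorem thm31Printed_kingFreeRG (hd1 : 1 ≤ d) (hd3 : d ≤ 3) (hL : 2 ≤ L) (hM₀ : 1 ≤ M₀) {a msq b₀ p : ℝ} (ha : 0 < a) (hmsq : 0 < msq)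
    (hb : 0 < b₀) (hp : 0 ≤ p) : (kingFreeRG (d := d) L M₀ a msq b₀ p).Thm31Printed := by
  obtain ⟨J, hJ⟩ := exists_J_largeField (d := d) L M₀ hd1 hd3 hL hM₀ ha hmsq hb hp
  refine ⟨J, 1, 0, one_pos, fun m k hm => ?_⟩
  simp only [RGData.smallFieldIntegral, RGData.largeFieldRemainder, kingFreeRG_chi, kingFreeRG_S, kingFreeRG_Z, kingFreeRG_μ, kingFreeRG_L,
    kingFreeRG_vol, kingFreeRG_b₀, kingFreeRG_p, zero_mul, add_zero]
  constructor
  · exact smallField_le_one (d := d) L M₀ ha hL hmsq b₀ p m k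
  · have h1 := one_sub_smallField_le_letter (d := d) L M₀ hd1 hd3 ha hL hmsq hb.le m k (p := p)
    have h2 := hJ m hm
    linarith

end Main

end Summit.QuantumFields.YangMills.BalabanUVNodes.N15KingModelRung.FreeField

end
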